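import Mathlib

/-!
# Newton–Kantorovich with a RIGHT inverse — the simplified-Newton residual contraction
# (`FilamentSkeletonRss`, child crux `TangentSkeletonNearStraight`, stmt-NavierStokesRegularity-28295, line
# `child_tangent_analytic_strip`, ∃-side of the registered stub `stub_analyticClosing`, step (iv))

Step (iv) of the hard stub `stub_analyticClosing` (`AnalyticNewtonClosing`) is "Newton–Kantorovich from residual
`2^{-cΓ^{1/4}}`" with a linearisation that has a RIGHT inverse of merely polynomial size `Γ^p` (step (iii)): a
super-exponentially small residual beats a polynomially large right inverse.  This file is the abstract Banach-space
kernel of that step, in the form the line needs (right inverse only — the joint curve ⊕ area-law linearisation is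
onto, not injective; no second derivative; explicit constants; the zero is the limit of the EXPLICIT simplified-Newton
iterates, with a geometric rate, so that parametrised versions can later be read off from uniform convergence):

* `residual_contraction` — one simplified-Newton step `x ↦ x − L f(x)` (`f′(x₀) ∘ L = id`) multiplies the residual by
  `q = δ‖L‖`, where `δ` bounds `‖f′(x) − f′(x₀)‖` on the ball (mean-value inequality against the frozen derivative);
* `iterate_bounds` — along the iterates: residual `≤ ‖f x₀‖ qⁿ`, distance `≤ ‖L‖‖f x₀‖(1 − qⁿ)/(1 − q)`, inside the ball;
* `iterate_tendsto` / `newton_kantorovich_right_inverse` — the iterates converge (complete `E`) to a zero `x⋆` of `f` in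
  the closed ball with `‖x⋆ − x₀‖ ≤ ‖L‖‖f x₀‖/(1 − q)` and `‖xₙ − x⋆‖ ≤ ‖L‖‖f x₀‖ qⁿ/(1 − q)`;
* `newton_kantorovich_lipschitz` — the Kantorovich form with a Lipschitz derivative: `‖L‖ ≤ β`, `‖f x₀‖ ≤ η`,
  `‖f′(x) − f′(x₀)‖ ≤ K‖x − x₀‖` on `closedBall x₀ r`, `2βKr ≤ 1`, `2βη ≤ r` ⇒ a zero within `2βη` of `x₀`.

HONEST FRAMING: textbook functional analysis ([Kantorovich–Akilov, Functional Analysis, Ch. XVIII §1]; [Deimling, Nonlinear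
Functional Analysis, §15]; folklore) serving a plan about a HYPOTHETICAL filament skeleton on the NEGATIVE side of a MODEL
route; no registered stub is closed by this file and nothing here bears on Navier–Stokes regularity or blow-up.
`--supports stmt-NavierStokesRegularity-28295`.
-/

set_option linter.dupNamespace false

noncomputable section

namespace Summit.NavierStokesRegularity.NavierStokesRegularity.Theorems.NewtonKantorovich

open Set Metric Filter Topology

variable {E F : Type*} [NormedAddCommGroup E] [NormedSpace ℝ E] [NormedAddCommGroup F] [NormedSpace ℝ F]

/-- The radius is nonnegative as soon as the start-up inequality `‖L‖‖f x₀‖ ≤ (1 − q) r` holds with `q < 1`. [folklore] -/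
theorem radius_nonneg {a q r : ℝ} (ha : 0 ≤ a) (hq1 : q < 1) (hr : a ≤ (1 - q) * r) : 0 ≤ r := by
  by_contra h
  have h' : r < 0 := lt_of_not_ge h
  have : (1 - q) * r < 0 := mul_neg_of_pos_of_neg (by linarith) h'
  linarith

/-- **One simplified-Newton step contracts the residual.**  If `f` is differentiable on the closed ball with derivative
`f′`, `L` is a right inverse of the frozen derivative `f′(x₀)`, `‖f′(x) − f′(x₀)‖ ≤ δ` on the ball, and both `x` and
`x − L f(x)` lie in the ball, then `‖f(x − L f(x))‖ ≤ δ‖L‖·‖f x‖`.  (Mean-value inequality against the constant linear map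
`f′(x₀)`: `f(x − L f x) = [f(x − L f x) − f x − f′(x₀)(−L f x)]`, because `f′(x₀) L = id`.) [folklore] -/
theorem residual_contraction {f : E → F} {f' : E → E →L[ℝ] F} {x₀ x : E} {r δ : ℝ} (L : F →L[ℝ] E)
    (hf : ∀ z ∈ closedBall x₀ r, HasFDerivWithinAt f (f' z) (closedBall x₀ r) z)
    (hL : ∀ y, f' x₀ (L y) = y) (hδ : ∀ z ∈ closedBall x₀ r, ‖f' z - f' x₀‖ ≤ δ)
    (hx : x ∈ closedBall x₀ r) (hTx : x - L (f x) ∈ closedBall x₀ r) :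
    ‖f (x - L (f x))‖ ≤ δ * ‖L‖ * ‖f x‖ := by
  have hmv := (convex_closedBall x₀ r).norm_image_sub_le_of_norm_hasFDerivWithin_le' hf hδ hx hTx
  have hkey : f (x - L (f x)) - f x - f' x₀ (x - L (f x) - x) = f (x - L (f x)) := by
    have : x - L (f x) - x = -(L (f x)) := by abel
    rw [this, map_neg, hL]
    abel
  rw [hkey] at hmv
  calc ‖f (x - L (f x))‖ ≤ δ * ‖x - L (f x) - x‖ := hmv
    _ = δ * ‖L (f x)‖ := by
        congr 1
        rw [show x - L (f x) - x = -(L (f x)) by abel, norm_neg]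
    _ ≤ δ * (‖L‖ * ‖f x‖) := by
        have hδ0 : 0 ≤ δ := le_trans (norm_nonneg _) (hδ x hx)
        exact mul_le_mul_of_nonneg_left (L.le_opNorm _) hδ0
    _ = δ * ‖L‖ * ‖f x‖ := by ring

/-- **Bounds along the simplified-Newton iterates** `x_{n+1} = xₙ − L f(xₙ)`: with `q < 1`, `δ‖L‖ ≤ q` and the start-up
inequality `‖L‖‖f x₀‖ ≤ (1 − q) r`, every iterate lies in `closedBall x₀ r`, its residual is `≤ ‖f x₀‖ qⁿ` and its
distance from `x₀` is `≤ ‖L‖‖f x₀‖(1 − qⁿ)/(1 − q)`. [folklore] -/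
theorem iterate_bounds {f : E → F} {f' : E → E →L[ℝ] F} {x₀ : E} {r δ q : ℝ} (L : F →L[ℝ] E)
    (hf : ∀ z ∈ closedBall x₀ r, HasFDerivWithinAt f (f' z) (closedBall x₀ r) z)
    (hL : ∀ y, f' x₀ (L y) = y) (hδ : ∀ z ∈ closedBall x₀ r, ‖f' z - f' x₀‖ ≤ δ)
    (hq : δ * ‖L‖ ≤ q) (hq1 : q < 1) (hr : ‖L‖ * ‖f x₀‖ ≤ (1 - q) * r)
    {xs : ℕ → E} (h0 : xs 0 = x₀) (hstep : ∀ n, xs (n + 1) = xs n - L (f (xs n))) (n : ℕ) :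
    xs n ∈ closedBall x₀ r ∧ ‖f (xs n)‖ ≤ ‖f x₀‖ * q ^ n ∧
      ‖xs n - x₀‖ ≤ ‖L‖ * ‖f x₀‖ * (1 - q ^ n) / (1 - q) := by
  have hr0 : 0 ≤ r := radius_nonneg (mul_nonneg (norm_nonneg _) (norm_nonneg _)) hq1 hr
  have hx₀ : x₀ ∈ closedBall x₀ r := mem_closedBall_self hr0
  have hδ0 : 0 ≤ δ := le_trans (norm_nonneg _) (hδ x₀ hx₀)
  have hq0 : 0 ≤ q := le_trans (mul_nonneg hδ0 (norm_nonneg _)) hq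
  have h1q : 0 < 1 - q := by linarith
  set a : ℝ := ‖L‖ * ‖f x₀‖ with ha
  have ha0 : 0 ≤ a := mul_nonneg (norm_nonneg _) (norm_nonneg _)
  -- the distance bound implies membership
  have hmem_of : ∀ m : ℕ, ‖xs m - x₀‖ ≤ a * (1 - q ^ m) / (1 - q) → xs m ∈ closedBall x₀ r := by
    intro m hm
    rw [mem_closedBall, dist_eq_norm]
    refine hm.trans ?_
    have hqm : 0 ≤ q ^ m := pow_nonneg hq0 m
    calc a * (1 - q ^ m) / (1 - q) ≤ a / (1 - q) := by
          apply div_le_div_of_nonneg_right _ h1q.le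
          nlinarith
      _ ≤ r := by rw [div_le_iff₀ h1q]; linarith
  -- induction on `n` for the pair (residual, distance)
  suffices H : ‖f (xs n)‖ ≤ ‖f x₀‖ * q ^ n ∧ ‖xs n - x₀‖ ≤ a * (1 - q ^ n) / (1 - q) from
    ⟨hmem_of n H.2, H.1, H.2⟩
  induction n with
  | zero => exact ⟨by simp [h0], by simp [h0]⟩
  | succ m ih =>
    have hmem : xs m ∈ closedBall x₀ r := hmem_of m ih.2
    -- distance of the next iterate
    have hdist : ‖xs (m + 1) - x₀‖ ≤ a * (1 - q ^ (m + 1)) / (1 - q) := by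
      have hst : ‖xs (m + 1) - xs m‖ ≤ a * q ^ m := by
        rw [hstep m, show xs m - L (f (xs m)) - xs m = -(L (f (xs m))) by abel, norm_neg]
        calc ‖L (f (xs m))‖ ≤ ‖L‖ * ‖f (xs m)‖ := L.le_opNorm _
          _ ≤ ‖L‖ * (‖f x₀‖ * q ^ m) := mul_le_mul_of_nonneg_left ih.1 (norm_nonneg _)
          _ = a * q ^ m := by rw [ha]; ring
      calc ‖xs (m + 1) - x₀‖ = ‖(xs (m + 1) - xs m) + (xs m - x₀)‖ := by congr 1; abel
        _ ≤ ‖xs (m + 1) - xs m‖ + ‖xs m - x₀‖ := norm_add_le _ _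
        _ ≤ a * q ^ m + a * (1 - q ^ m) / (1 - q) := add_le_add hst ih.2
        _ = a * (1 - q ^ (m + 1)) / (1 - q) := by
            field_simp
            ring
    have hmem' : xs (m + 1) ∈ closedBall x₀ r := hmem_of (m + 1) hdist
    refine ⟨?_, hdist⟩
    have hT : xs m - L (f (xs m)) ∈ closedBall x₀ r := by rw [← hstep m]; exact hmem'
    have hc := residual_contraction L hf hL hδ hmem hT
    rw [← hstep m] at hc
    calc ‖f (xs (m + 1))‖ ≤ δ * ‖L‖ * ‖f (xs m)‖ := hc
      _ ≤ q * (‖f x₀‖ * q ^ m) := mul_le_mul hq ih.1 (norm_nonneg _) hq0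
      _ = ‖f x₀‖ * q ^ (m + 1) := by ring

/-- Consecutive simplified-Newton iterates are geometrically close: `‖x_{n+1} − xₙ‖ ≤ ‖L‖‖f x₀‖·qⁿ`. [folklore] -/
theorem iterate_step_le {f : E → F} {f' : E → E →L[ℝ] F} {x₀ : E} {r δ q : ℝ} (L : F →L[ℝ] E)
    (hf : ∀ z ∈ closedBall x₀ r, HasFDerivWithinAt f (f' z) (closedBall x₀ r) z)
    (hL : ∀ y, f' x₀ (L y) = y) (hδ : ∀ z ∈ closedBall x₀ r, ‖f' z - f' x₀‖ ≤ δ)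
    (hq : δ * ‖L‖ ≤ q) (hq1 : q < 1) (hr : ‖L‖ * ‖f x₀‖ ≤ (1 - q) * r)
    {xs : ℕ → E} (h0 : xs 0 = x₀) (hstep : ∀ n, xs (n + 1) = xs n - L (f (xs n))) (n : ℕ) :
    dist (xs n) (xs (n + 1)) ≤ ‖L‖ * ‖f x₀‖ * q ^ n := by
  have hb := (iterate_bounds L hf hL hδ hq hq1 hr h0 hstep n).2.1
  rw [dist_comm, dist_eq_norm, hstep n, show xs n - L (f (xs n)) - xs n = -(L (f (xs n))) by abel, norm_neg]
  calc ‖L (f (xs n))‖ ≤ ‖L‖ * ‖f (xs n)‖ := L.le_opNorm _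
    _ ≤ ‖L‖ * (‖f x₀‖ * q ^ n) := mul_le_mul_of_nonneg_left hb (norm_nonneg _)
    _ = ‖L‖ * ‖f x₀‖ * q ^ n := by ring

/-- **Convergence of the simplified-Newton iterates to a zero** (complete `E`).  Under the hypotheses of `iterate_bounds`
the iterates converge to some `x⋆ ∈ closedBall x₀ r` with `f x⋆ = 0`, `‖x⋆ − x₀‖ ≤ ‖L‖‖f x₀‖/(1 − q)` and the geometric
rate `‖xₙ − x⋆‖ ≤ ‖L‖‖f x₀‖·qⁿ/(1 − q)`. [folklore] -/
theorem iterate_tendsto [CompleteSpace E] {f : E → F} {f' : E → E →L[ℝ] F} {x₀ : E} {r δ q : ℝ} (L : F →L[ℝ] E)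
    (hf : ∀ z ∈ closedBall x₀ r, HasFDerivWithinAt f (f' z) (closedBall x₀ r) z)
    (hL : ∀ y, f' x₀ (L y) = y) (hδ : ∀ z ∈ closedBall x₀ r, ‖f' z - f' x₀‖ ≤ δ)
    (hq : δ * ‖L‖ ≤ q) (hq1 : q < 1) (hr : ‖L‖ * ‖f x₀‖ ≤ (1 - q) * r)
    {xs : ℕ → E} (h0 : xs 0 = x₀) (hstep : ∀ n, xs (n + 1) = xs n - L (f (xs n))) :
    ∃ xinf ∈ closedBall x₀ r, Tendsto xs atTop (𝓝 xinf) ∧ f xinf = 0 ∧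
      ‖xinf - x₀‖ ≤ ‖L‖ * ‖f x₀‖ / (1 - q) ∧
      ∀ n, ‖xs n - xinf‖ ≤ ‖L‖ * ‖f x₀‖ * q ^ n / (1 - q) := by
  have hr0 : 0 ≤ r := radius_nonneg (mul_nonneg (norm_nonneg _) (norm_nonneg _)) hq1 hr
  have hx₀ : x₀ ∈ closedBall x₀ r := mem_closedBall_self hr0
  have hδ0 : 0 ≤ δ := le_trans (norm_nonneg _) (hδ x₀ hx₀)
  have hq0 : 0 ≤ q := le_trans (mul_nonneg hδ0 (norm_nonneg _)) hq
  have h1q : 0 < 1 - q := by linarith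
  have hB := iterate_bounds L hf hL hδ hq hq1 hr h0 hstep
  have hstep_le := iterate_step_le L hf hL hδ hq hq1 hr h0 hstep
  have hcs : CauchySeq xs := cauchySeq_of_le_geometric q (‖L‖ * ‖f x₀‖) hq1 hstep_le
  obtain ⟨xinf, hlim⟩ := cauchySeq_tendsto_of_complete hcs
  have hmem : xinf ∈ closedBall x₀ r :=
    isClosed_closedBall.mem_of_tendsto hlim (Eventually.of_forall fun n => (hB n).1)
  -- continuity of `f` within the ball at the limit
  have hcont : ContinuousWithinAt f (closedBall x₀ r) xinf := (hf xinf hmem).continuousWithinAt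
  have hlimW : Tendsto xs atTop (𝓝[closedBall x₀ r] xinf) :=
    tendsto_nhdsWithin_iff.mpr ⟨hlim, Eventually.of_forall fun n => (hB n).1⟩
  have hfx : Tendsto (fun n => f (xs n)) atTop (𝓝 (f xinf)) := hcont.tendsto.comp hlimW
  -- the residuals tend to zero
  have hres0 : Tendsto (fun n => f (xs n)) atTop (𝓝 0) := by
    rw [tendsto_zero_iff_norm_tendsto_zero]
    have hgeom : Tendsto (fun n => ‖f x₀‖ * q ^ n) atTop (𝓝 0) := by
      simpa using (tendsto_pow_atTop_nhds_zero_of_lt_one hq0 hq1).const_mul ‖f x₀‖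
    exact squeeze_zero (fun n => norm_nonneg _) (fun n => (hB n).2.1) hgeom
  have hzero : f xinf = 0 := tendsto_nhds_unique hfx hres0
  -- distance bounds pass to the limit
  have hdist : ‖xinf - x₀‖ ≤ ‖L‖ * ‖f x₀‖ / (1 - q) := by
    have ht : Tendsto (fun n => ‖xs n - x₀‖) atTop (𝓝 ‖xinf - x₀‖) := (hlim.sub_const x₀).norm
    refine le_of_tendsto ht (Eventually.of_forall fun n => ?_)
    refine (hB n).2.2.trans ?_
    apply div_le_div_of_nonneg_right _ h1q.le
    have : 0 ≤ q ^ n := pow_nonneg hq0 n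
    nlinarith [mul_nonneg (norm_nonneg L) (norm_nonneg (f x₀))]
  have hrate : ∀ n, ‖xs n - xinf‖ ≤ ‖L‖ * ‖f x₀‖ * q ^ n / (1 - q) := by
    intro n
    have h := dist_le_of_le_geometric_of_tendsto q (‖L‖ * ‖f x₀‖) hq1 hstep_le hlim n
    rw [dist_eq_norm] at h
    exact h
  exact ⟨xinf, hmem, hlim, hzero, hdist, hrate⟩

/-- **Newton–Kantorovich with a right inverse (residual form).**  `E` complete; `f` differentiable on `closedBall x₀ r`
with derivative `f′`; `L` a bounded right inverse of `f′(x₀)`; `‖f′(x) − f′(x₀)‖ ≤ δ` on the ball with `δ‖L‖ ≤ q < 1`;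
start-up inequality `‖L‖‖f x₀‖ ≤ (1 − q) r`.  Then `f` has a zero `x⋆` in the ball with `‖x⋆ − x₀‖ ≤ ‖L‖‖f x₀‖/(1 − q)`.
[folklore] -/
theorem newton_kantorovich_right_inverse [CompleteSpace E] {f : E → F} {f' : E → E →L[ℝ] F} {x₀ : E} {r δ q : ℝ}
    (L : F →L[ℝ] E)
    (hf : ∀ z ∈ closedBall x₀ r, HasFDerivWithinAt f (f' z) (closedBall x₀ r) z)
    (hL : ∀ y, f' x₀ (L y) = y) (hδ : ∀ z ∈ closedBall x₀ r, ‖f' z - f' x₀‖ ≤ δ)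
    (hq : δ * ‖L‖ ≤ q) (hq1 : q < 1) (hr : ‖L‖ * ‖f x₀‖ ≤ (1 - q) * r) :
    ∃ x ∈ closedBall x₀ r, f x = 0 ∧ ‖x - x₀‖ ≤ ‖L‖ * ‖f x₀‖ / (1 - q) := by
  -- the explicit simplified-Newton sequence
  let T : E → E := fun x => x - L (f x)
  let xs : ℕ → E := fun n => T^[n] x₀
  have h0 : xs 0 = x₀ := rfl
  have hstep : ∀ n, xs (n + 1) = xs n - L (f (xs n)) := fun n => by
    show T^[n + 1] x₀ = T^[n] x₀ - L (f (T^[n] x₀))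
    rw [Function.iterate_succ_apply']
  obtain ⟨xinf, hmem, -, hzero, hdist, -⟩ := iterate_tendsto L hf hL hδ hq hq1 hr h0 hstep
  exact ⟨xinf, hmem, hzero, hdist⟩

/-- **Newton–Kantorovich, Lipschitz form.**  `E` complete; `f` differentiable on `closedBall x₀ r` with derivative `f′`;
`L` a right inverse of `f′(x₀)` with `‖L‖ ≤ β`; residual `‖f x₀‖ ≤ η`; `‖f′(x) − f′(x₀)‖ ≤ K‖x − x₀‖` on the ball
(`0 ≤ K`); and the two Kantorovich inequalities `2βKr ≤ 1`, `2βη ≤ r`.  Then `f` has a zero within `2βη` of `x₀` (in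
particular in the ball).  This is the shape used by step (iv) of `stub_analyticClosing`: `β = Γ^p` (polynomial right
inverse), `η = 2^{-cΓ^{1/4}}` (pre-converged residual), `K`, `r` polynomial in `Γ`. [folklore] -/
theorem newton_kantorovich_lipschitz [CompleteSpace E] {f : E → F} {f' : E → E →L[ℝ] F} {x₀ : E} {r β η K : ℝ}
    (L : F →L[ℝ] E)
    (hf : ∀ z ∈ closedBall x₀ r, HasFDerivWithinAt f (f' z) (closedBall x₀ r) z)
    (hL : ∀ y, f' x₀ (L y) = y) (hβ : ‖L‖ ≤ β) (hη : ‖f x₀‖ ≤ η) (hK0 : 0 ≤ K)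
    (hK : ∀ z ∈ closedBall x₀ r, ‖f' z - f' x₀‖ ≤ K * ‖z - x₀‖)
    (h1 : 2 * β * K * r ≤ 1) (h2 : 2 * β * η ≤ r) :
    ∃ x ∈ closedBall x₀ r, f x = 0 ∧ ‖x - x₀‖ ≤ 2 * β * η := by
  have hβ0 : 0 ≤ β := (norm_nonneg L).trans hβ
  have hη0 : 0 ≤ η := (norm_nonneg _).trans hη
  have hr0 : 0 ≤ r := by nlinarith
  -- `δ = K r`, `q = 1/2`
  have hδ : ∀ z ∈ closedBall x₀ r, ‖f' z - f' x₀‖ ≤ K * r := by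
    intro z hz
    refine (hK z hz).trans ?_
    rw [mem_closedBall, dist_eq_norm] at hz
    exact mul_le_mul_of_nonneg_left hz hK0
  have hq : K * r * ‖L‖ ≤ 1 / 2 := by
    calc K * r * ‖L‖ ≤ K * r * β := mul_le_mul_of_nonneg_left hβ (mul_nonneg hK0 hr0)
      _ ≤ 1 / 2 := by nlinarith
  have hstart : ‖L‖ * ‖f x₀‖ ≤ (1 - 1 / 2) * r := by
    calc ‖L‖ * ‖f x₀‖ ≤ β * η := mul_le_mul hβ hη (norm_nonneg _) hβ0
      _ ≤ (1 - 1 / 2) * r := by linarith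
  obtain ⟨x, hx, hfx, hdist⟩ :=
    newton_kantorovich_right_inverse L hf hL hδ hq (by norm_num : (1 / 2 : ℝ) < 1) hstart
  refine ⟨x, hx, hfx, ?_⟩
  calc ‖x - x₀‖ ≤ ‖L‖ * ‖f x₀‖ / (1 - 1 / 2) := hdist
    _ = 2 * (‖L‖ * ‖f x₀‖) := by ring
    _ ≤ 2 * (β * η) := by
        have := mul_le_mul hβ hη (norm_nonneg _) hβ0
        linarith
    _ = 2 * β * η := by ring

end Summit.NavierStokesRegularity.NavierStokesRegularity.Theorems.NewtonKantorovich
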